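import Summits.BirchSwinnertonDyer.BirchSwinnertonDyer.Theorems.SignedBaseChangeAnticyclotomicEisensteinDivisibilityAdmdefBipartiteNVGlue
import Summits.BirchSwinnertonDyer.BirchSwinnertonDyer.Theorems.SignedBaseChangeAnticyclotomicEisensteinDivisibilityBdpLowerHalfSemistable
import Summits.BirchSwinnertonDyer.BirchSwinnertonDyer.Theorems.SignedBaseChangeAnticyclotomicEisensteinDivisibilityAdmdefUnitLambdaOfLoc
import Literature.NumberTheory.EllipticCurves.CastellaHsuKunduLeeLiu2025.SignedBipartiteSystemTransferClassDictionary
import HarnessLib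

/-!
# Line `admdef` v17: the ROOT DICHOTOMY on cell γ′ (some `q ∣ N` with `E[p]` unramified, `p ∤ h_K`) — S1 there is KERNEL
# modulo five cited facts OFF the non-primitive locus (NP), and the research stub γ′ shrinks to «C⁺⁺ on γ′ ∩ (NP)»
# (crux `AnticyclotomicEisensteinDivisibility`, stmt-BirchSwinnertonDyer-20727; LEAD seat bsd-line-sbc-p1 gen 21,
# `--supports stmt-BirchSwinnertonDyer-20727`)

WHY THIS FILE.  v16 (LEAD g21, `…AdmdefRootDichotomy`) wired Howard's primitive-root criterion into the β-cell composition.  Nothing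
in that mechanism uses the β binders: the typed CHKLL25 Thm. 7.4-with-construction (`thm74_eq72_exists_signedSystem_transferClass_dictionary`,
cite conjunct (16)) delivers frame + transfer class + `+` system on ANY cell at `p ∤ h_K`; the second reciprocity law at the root
(`…AdmdefUnitLambdaOfLoc.hasUnitLambda_of_limitBaseClass_res_ne_zero`, LEAD g19) turns a visible bottom class into [NV]; §Glue
(`…AdmdefBipartiteNVGlue.exists_isCWBDPLFunction_charIdeal_map_le_of_bipartiteNV`: LV19 Thm 1.4, CW24 Lemma 6.7, CW24 rel ≤ sgn,
CHKLL25 Thm 7.5) turns [NV] into C⁺⁺ at the point; and the width seat's frame concordance (p634869) pushes C⁺⁺ to the registered S1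
currency — all cell-free.  So the γ′ stub of the line (`stub_bdpLowerHalfRatSS_unram`: S1 on the cell «some `q ∣ N` has `E[p]`
unramified», v1–v16 the raw S1 text with NO structure and no print) can be cut exactly like (Anch±) was:

* `exists_pow_mul_mem_span_of_cwPoint` — **pointwise frame glue** (cell-free): a Castella–Wan frame with the rational inclusion along
  every structure map at ONE point `(ι, W, K, v, v̄, κ, γ, f)` gives the registered S1 conclusion at that point in every BDP frame
  (the width seat w7's proof, the cell binders removed).
* `cwPoint_of_facts_of_not_rootInvisible` — **C⁺⁺ at a point OFF the non-primitive locus (cell-free)**: if (NP) FAILS at `(W, K, p, N, f)`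
  then for every non-split datum the pinned `+` tuple of conjunct (16) has a visible root, hence [NV] (root criterion), hence C⁺⁺ at the
  point by §Glue — modulo the cites (2), (9), (10), (11), (16) taken as hypotheses.
* `bdpLowerHalfRatSS_unram_of_facts_of_unramNP` — **the γ′ stub text DERIVED** from those five cites and the NEW research text
  `UnramPlusRatNPNS` = «C⁺⁺ (CHKLL25 Thm 7.1's conclusion shape: ∃ CW frame with the rational inclusion) on cell γ′, asked ONLY under (NP)»:
  by cases on (NP) at the point.

HONEST FRAMING / WHERE (NP) IS AUTOMATIC ON γ′.  If the unramified prime `q ∥ N` is SPLIT multiplicative then `p ∣ c_q = ord_q(Δ)` and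
Jetchev 2008 Thm. 1.4 (`ord_p [E(K) : ℤy_K] ≥ max_q ord_p(c_q)`, with `c_v = c_{v̄} = c_q` over the Heegner field) forces the Heegner point
to be `p`-divisible, i.e. (NP) holds and this file closes NOTHING there (the `+` system is imprimitive; a unit `λ` is not expected); if
every unramified bad prime is NON-split multiplicative (`a_q = −1`, `c_q ∈ {1, 2}`) the primitive locus is non-empty and S1 is kernel modulo
the five cites on it.  CONDITIONAL (audit `proof.conditional`); BSD / the crux / S1 on γ′ ∩ (NP) are NOT proved by this file.

References: [cite: CastellaEtAl2025, Thm. 7.4 (second law), (7.2), Thm. 7.5, §7.4 (arXiv:2308.10474v2 pp. 30–33)]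
[cite: Howard2006, Thm. 3.2.3 (c)] [cite: CastellaWan2023, Prop. 2.1, Lemma 6.7, proof of Thm. 6.8 (MS pp. 5–6, 27–31)]
[cite: Castella2018, Thm. 3.1] [cite: Jetchev2008, Thm. 1.4, Cor. 1.5 (Compos. Math. 144, arXiv:math/0703431 p. 3)]
[cite: LongoVigni2019, Thm. 1.4].
-/

-- D-0017: single-problem summit, the namespace repeats the problem name by design.
set_option linter.dupNamespace false
set_option autoImplicit false

noncomputable section

open scoped Classical NumberField

open NumberField IsDedekindDomain Field
  Literature.NumberTheory.EllipticCurves Literature.NumberTheory.EllipticCurves.ModularForms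
  Literature.NumberTheory.EllipticCurves.Rank1Residual Literature.NumberTheory.EllipticCurves.Castella2018
  Literature.NumberTheory.EllipticCurves.CastellaWan2024 Literature.NumberTheory.GaloisRepresentations
  Literature.NumberTheory.EllipticCurves.YanZhu2026 Literature.NumberTheory.Automorphic
  Summit.BirchSwinnertonDyer.Rank1Residual.X11b Summit.BirchSwinnertonDyer.Rank1Residual.X11b.Halves
  Summit.BirchSwinnertonDyer.BirchSwinnertonDyer.Theorems
open Literature.NumberTheory.EllipticCurves.AcSigned Literature.NumberTheory.EllipticCurves.CastellaHsuKunduLeeLiu2025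
  Literature.NumberTheory.EllipticCurves.BertoliniDarmon2005 Literature.NumberTheory.EllipticCurves.IwasawaDual
open WeierstrassCurve (geomTorsion)

namespace Summit.BirchSwinnertonDyer.BirchSwinnertonDyer.Theorems.SignedBaseChangeAcDivAdmdefUnramRootDichotomy

open Summit.BirchSwinnertonDyer.BirchSwinnertonDyer.Theses.SignedBaseChange
open Summit.BirchSwinnertonDyer.BirchSwinnertonDyer.Theorems

/-! ## §1 Pointwise frame glue (cell-free) -/

/-- **Pointwise frame glue (cell-free).**  At one point `(ι, W, K, v, v̄, κ, γ, f)` with `p ≥ 5` good, `K` imaginary quadratic, `p` split,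
`κ` anticyclotomic with topological generator `γ`: a Castella–Wan BDP frame `(Ω_K ≠ 0, Ω_p, L_W)` (`IsCWBDPLFunction`) carrying the rational
inclusion `(p^k)·Ch_Λ(X_ac)·R₀⟦T⟧ ⊆ (L_W)` along every structure map `ℤ_p → R₀` gives, for EVERY BDP frame `(Ω_K′ ≠ 0, Ω_p′, L)`
(`IsBDPLFunction`, Castella 2018 Thm 3.1's currency) and the canonical structure maps into `𝒪_{ℂ_p}`, the registered S1 conclusion
`∃ k, p^k · Ch_Λ(X_ac)^J ⊆ (L^{J₀})`.  The width seat w7's proof (`…BdpLowerHalfSemistable.bdpLowerHalfRatSS_semistable_of_CHKLL`) with the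
cell binders removed: `J/J₀` rigidity, frame concordance (p634869), push along `R₀ → 𝒪_{ℂ_p}`.
[cite: CastellaWan2023, Prop. 2.1 (MS pp. 5–6)] [cite: Castella2018, Thm. 3.1 and Def. 2.2] -/
theorem exists_pow_mul_mem_span_of_cwPoint {p : ℕ} [Fact p.Prime] (ι : PadicAlgCl p ≃+* ℂ) (W : WeierstrassCurve ℚ) [W.IsElliptic]
    [W.IsGloballyMinimal] (K : Type) [Field K] [NumberField K] (v vbar : HeightOneSpectrum (𝓞 K)) (κ : ZpExtension K p)
    (γ : absoluteGaloisGroup K) [hγF : Fact (κ.IsTopGenerator γ)] {N : ℕ} [NeZero N] {f : CuspForm (CongruenceSubgroup.Gamma0 N) 2}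
    (hN : (N : ℤ) = W.conductorNorm ℤ) (hp : 5 ≤ p) (hgood : W.HasGoodReductionAtPrime p) (hK : IsImaginaryQuadratic K)
    (hsplit : ((Ideal.span {(p : ℤ)}).primesOver (𝓞 K)).ncard = 2) (hκ : κ.IsAnticyclotomic)
    (hCpt : ∃ (ΩKw : ℂ) (Ωpw : (unrIntegers p)ˣ) (LW : UnrSeries p), ΩKw ≠ 0 ∧
      IsCWBDPLFunction ι v κ γ f (NumberField.discr K) ΩKw ((Ωpw : unrIntegers p) : ℂ_[p]) LW ∧
      ∀ (j : ℤ_[p] →+* unrIntegers p),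
        (∀ x : ℤ_[p], ((j x : unrIntegers p) : ℂ_[p]) = algebraMap ℚ_[p] ℂ_[p] (x : ℚ_[p])) →
        ∃ k : ℕ,
          Ideal.span {PowerSeries.C ((p : unrIntegers p) ^ k)} *
              (Castella2018.AcSelmer.XAc.charIdeal (W.baseChange K) p κ vbar ∅ γ).map (PowerSeries.map j) ≤
            Ideal.span {LW})
    (ΩK : ℂ) (Ωp' : (unrIntegers p)ˣ) (L : UnrSeries p) (hΩK : ΩK ≠ 0)
    (hL : IsBDPLFunction ι v κ γ f ΩK ((Ωp' : unrIntegers p) : ℂ_[p]) L)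
    (J : ℤ_[p] →+* PadicComplexInt p) (hJ : ∀ x : ℤ_[p], ((J x : PadicComplexInt p) : ℂ_[p]) = ((x : ℚ_[p]) : ℂ_[p]))
    (J₀ : unrIntegers p →+* PadicComplexInt p) (hJ₀ : ∀ x : unrIntegers p, ((J₀ x : PadicComplexInt p) : ℂ_[p]) = (x : ℂ_[p])) :
    ∃ k : ℕ, ∀ y ∈ (Castella2018.AcSelmer.XAc.charIdeal (W.baseChange K) p κ vbar ∅ γ).map (PowerSeries.map J),
      PowerSeries.C (((p : ℕ) : PadicComplexInt p) ^ k) * y ∈ Ideal.span {PowerSeries.map J₀ L} := by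
  -- adapted from Theorems/…BdpLowerHalfSemistable.lean `bdpLowerHalfRatSS_semistable_of_CHKLL` (width seat w7), cell binders removed
  have hprime : p.Prime := Fact.out
  have hp2 : p ≠ 2 := by omega
  obtain ⟨ΩKw, Ωpw, LW, hΩKw, hLW, hk⟩ := hCpt
  obtain ⟨k, hkle⟩ := hk (toUnr p) (coe_toUnr p)
  -- the structure maps of S1 are the canonical ones (`𝒪_{ℂ_p} ↪ ℂ_p` is injective)
  have hJ₀eq : J₀ = R1.unrToCpInt p :=
    RingHom.ext fun x ↦ Subtype.ext ((hJ₀ x).trans (R1.coe_unrToCpInt p x).symm)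
  subst hJ₀eq
  have hJeq : J = R1.toCpInt p :=
    RingHom.ext fun x ↦ Subtype.ext ((hJ x).trans (R1.coe_toCpInt p x).symm)
  subst hJeq
  -- the two frames generate the same ideal of `𝒪_{ℂ_p}⟦T⟧` (width seat's concordance theorem)
  have hN' : (W.conductorNorm ℤ : ℕ) = N := by exact_mod_cast hN.symm
  have hpN : ¬ p ∣ N := by
    rw [← hN']
    exact not_dvd_conductorNorm_of_hasGoodReductionAtPrime W hgood
  have hpD : ¬ (p : ℤ) ∣ NumberField.discr K :=
    not_dvd_discr_of_ncard_primesOver hprime (by rw [hK.1]; exact hsplit)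
  have hconc : Ideal.span {PowerSeries.map (R1.unrToCpInt p) LW} =
      Ideal.span {PowerSeries.map (R1.unrToCpInt p) L} :=
    SignedBaseChangeAcDivFrameConcordance.span_map_eq_of_isCWBDPLFunction_of_isBDPLFunction hp2 hK hκ
      hγF.out hpN hpD hΩKw hΩK (coe_units_unrIntegers_ne_zero Ωpw) (coe_units_unrIntegers_ne_zero Ωp') hLW hL
  -- push the inclusion along `R₀ → 𝒪_{ℂ_p}`
  refine ⟨k, fun y hy ↦ ?_⟩
  have hmap := Ideal.map_mono (f := PowerSeries.map (R1.unrToCpInt p)) hkle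
  rw [Ideal.map_mul, Ideal.map_span, Set.image_singleton, Ideal.map_span, Set.image_singleton, Ideal.map_map,
    ← R1.map_toCpInt_eq_comp, PowerSeries.map_C, map_pow, map_natCast, hconc] at hmap
  exact hmap (Ideal.mul_mem_mul (Ideal.mem_span_singleton_self _) hy)

/-! ## §2 C⁺⁺ at a point OFF the non-primitive locus, from five cited facts (cell-free) -/

/-- **C⁺⁺ at a point OFF the non-primitive locus (cell-free), modulo five cites.**  Hypotheses BY NAME: LV19 Thm 1.4 (2), CW24 Lemma 6.7 (9),
CW24 «`Sel^{±,rel} ≤ Sel_±`» (10), CHKLL25 Thm 7.5 (11), CHKLL25 Thm 7.4-with-construction (16).  At a point `(ι, W, K, 𝔭, 𝔭bar, κ, γ, f)` with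
`p ≥ 5` good, `a_p = 0`, `ρ̄` onto, `K` imaginary quadratic Heegner for `N`, `p` split, `(N, D_K) = 1`, `p ∤ h_K`, `κ` anticyclotomic (NO cell
binder): IF (NP) fails — no pinned `+` tuple at `(W, K, p, N, f)` has its bottom class invisible at every admissible Frobenius — THEN for every
non-split datum at `𝔭` the tuple of (16) has a VISIBLE root, so `B.HasUnitLambda N` (`…AdmdefUnitLambdaOfLoc.hasUnitLambda_of_limitBaseClass_res_ne_zero`),
and §Glue (`…AdmdefBipartiteNVGlue.exists_isCWBDPLFunction_charIdeal_map_le_of_bipartiteNV`) gives C⁺⁺ at the point: a Castella–Wan frame with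
`∀ j, ∃ k, (p^k)·Ch_Λ(X_ac)^j ⊆ (L)`.  [cite: CastellaEtAl2025, Thm. 7.4 second law, (7.2), Thm. 7.5 (arXiv:2308.10474v2 p0030 L50–L62, p0031 L1–L30)]
[cite: Howard2006, Thm. 3.2.3 (c)] [cite: CastellaWan2023, Lemma 6.7, proof of Thm. 6.8 (MS pp. 27–31)] [cite: LongoVigni2019, Thm. 1.4] -/
theorem cwPoint_of_facts_of_not_rootInvisible
    (h2 : ∀ (W : WeierstrassCurve ℚ) [W.IsGloballyMinimal] (K : Type) [Field K] [NumberField K]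
      (p : ℕ) [Fact p.Prime] (κ : ZpExtension K p) (𝔭 𝔭' : HeightOneSpectrum (𝓞 K)),
      longoVigni2019_thm14_signedSelmerDual_rank_one W K p κ 𝔭 𝔭')
    (h67 : ∀ (N : ℕ) [NeZero N] (W : WeierstrassCurve ℚ) [W.IsGloballyMinimal] (K : Type) [Field K] [NumberField K]
      (p : ℕ) [Fact p.Prime] (κ : ZpExtension K p) (𝔭 𝔭' : HeightOneSpectrum (𝓞 K)),
      castellaWan2024_lemma67_finrank_torsionCharIdeal N W K p κ 𝔭 𝔭')
    (h5 : ∀ (N : ℕ) [NeZero N] (W : WeierstrassCurve ℚ) [W.IsGloballyMinimal] (K : Type) [Field K] [NumberField K]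
      (p : ℕ) [Fact p.Prime] (κ : ZpExtension K p) (𝔭 𝔭' : HeightOneSpectrum (𝓞 K)),
      castellaWan2024_proofThm68_selmerRel_le_selmerSgn N W K p κ 𝔭 𝔭')
    (h75 : ∀ (N : ℕ) [NeZero N] (W : WeierstrassCurve ℚ) [W.IsGloballyMinimal] (K : Type) [Field K] [NumberField K]
      (p : ℕ) [Fact p.Prime] (κ : ZpExtension K p) (𝔭 𝔭' : HeightOneSpectrum (𝓞 K)),
      thm75_howard_rank_one_sq_le_and_le_of_hasUnitLambda N W K p κ 𝔭 𝔭')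
    (hP : thm74_eq72_exists_signedSystem_transferClass_dictionary)
    {p : ℕ} [Fact p.Prime] (ι : PadicAlgCl p ≃+* ℂ) (W : WeierstrassCurve ℚ) [W.IsElliptic]
    [W.IsGloballyMinimal] (K : Type) [Field K] [NumberField K]
    (𝔭 𝔭bar : HeightOneSpectrum (𝓞 K)) (κ : ZpExtension K p) (γ : absoluteGaloisGroup K)
    [hγF : Fact (κ.IsTopGenerator γ)] {N : ℕ} [NeZero N] {f : CuspForm (CongruenceSubgroup.Gamma0 N) 2}
    (hf : IsNewformOf W f)
    (hN : (N : ℤ) = W.conductorNorm ℤ) (hp : 5 ≤ p) (hgood : W.HasGoodReductionAtPrime p) (hap : W.frobeniusTrace p = 0)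
    (hsurj : Surj W p) (hK : IsImaginaryQuadratic K)
    (h𝔭 : ((p : ℕ) : 𝓞 K) ∈ 𝔭.asIdeal)
    (hι : ∀ (w : InfinitePlace K) (k : 𝓞 K), k ∈ 𝔭.asIdeal ↔ ‖ι.symm (w.embedding (k : K))‖ < 1)
    (h𝔭bar : ((p : ℕ) : 𝓞 K) ∈ 𝔭bar.asIdeal) (hne : 𝔭bar ≠ 𝔭)
    (hHeeg : ∀ ℓ : ℕ, ℓ.Prime → ℓ ∣ N → ((Ideal.span {(ℓ : ℤ)}).primesOver (𝓞 K)).ncard = 2)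
    (hcop : IsCoprime (N : ℤ) (NumberField.discr K)) (hh : ¬ p ∣ NumberField.classNumber K) (hac : κ.IsAnticyclotomic)
    (hnotNP : ¬ (∃ (ι : PadicAlgCl p ≃+* ℂ) (𝔭 𝔭bar : HeightOneSpectrum (𝓞 K)) (κ : ZpExtension K p) (γ : absoluteGaloisGroup K)
      (hγ : κ.IsTopGenerator γ) (h𝔭 : ((p : ℕ) : 𝓞 K) ∈ 𝔭.asIdeal) (hne : 𝔭bar ≠ 𝔭)
      (h𝔭ns : AcSigned.IsNonsplitIn κ 𝔭) (γ𝔭 : absoluteGaloisGroup (𝔭.adicCompletion K))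
      (hγ𝔭 : κ (resGalOfEmb (closureEmb (K := K) (𝔭.adicCompletion K)) γ𝔭) = κ γ)
      (ΩK : ℂ) (Ωp : (unrIntegers p)ˣ) (L : UnrSeries p)
      (z : AcSigned.selmerLambdaAdic (W.baseChange K) p κ γ (fun _ ↦ .sgn 1))
      (B : CastellaHsuKunduLeeLiu2025.SignedBipartiteSystem W K p κ),
      κ.IsAnticyclotomic ∧ (∀ (w : InfinitePlace K) (k : 𝓞 K), k ∈ 𝔭.asIdeal ↔ ‖ι.symm (w.embedding (k : K))‖ < 1) ∧
      ((p : ℕ) : 𝓞 K) ∈ 𝔭bar.asIdeal ∧ ΩK ≠ 0 ∧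
      IsCWBDPLFunction ι 𝔭 κ γ f (NumberField.discr K) ΩK ((Ωp : unrIntegers p) : ℂ_[p]) L ∧
      AcSigned.TransferInputs (W.baseChange K) p κ γ hγ 𝔭 h𝔭ns γ𝔭 hγ𝔭 𝔭bar (fun h ↦ hne h.symm) h𝔭 1 z L ∧
      CastellaHsuKunduLeeLiu2025.IsSignedBipartiteSystem W K p κ γ N 1 B ∧ B.IsLimitBaseClass z.1 ∧
      ∀ (q : ℕ), IsAdmissiblePrime N K (fun ℓ ↦ W.frobeniusTrace ℓ) p 1 q →
        ∀ (v : HeightOneSpectrum (𝓞 K)), ((q : ℕ) : 𝓞 K) ∈ v.asIdeal →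
        ∀ 𝔓 ∈ v.primesAbove, ∀ (φ : absoluteGaloisGroup K) (hφ : φ ∈ κ.kerSubgroup),
          φ ∈ 𝔓.decompositionSubgroup (absoluteGaloisGroup K) → IsArithFrobAt (𝓞 K) φ 𝔓 →
          resOfLe (geomTorsion (W.baseChange K) ((p : ℤ) ^ 1))
            ((Subgroup.zpowers_le.mpr hφ).trans (κ.kerSubgroup_le_layerSubgroup 0)) (z.1 0 1) = 0)) :
    ∃ (ΩK : ℂ) (Ωp : (unrIntegers p)ˣ) (L : UnrSeries p),
      ΩK ≠ 0 ∧
      IsCWBDPLFunction ι 𝔭 κ γ f (NumberField.discr K) ΩK ((Ωp : unrIntegers p) : ℂ_[p]) L ∧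
      ∀ (j : ℤ_[p] →+* unrIntegers p),
        (∀ x : ℤ_[p], ((j x : unrIntegers p) : ℂ_[p]) = algebraMap ℚ_[p] ℂ_[p] (x : ℚ_[p])) →
        ∃ k : ℕ,
          Ideal.span {PowerSeries.C ((p : unrIntegers p) ^ k)} *
              (Castella2018.AcSelmer.XAc.charIdeal (W.baseChange K) p κ 𝔭bar ∅ γ).map (PowerSeries.map j) ≤
            Ideal.span {L} := by
  refine SignedBaseChangeAcDivAdmdefBipartiteNVGlue.exists_isCWBDPLFunction_charIdeal_map_le_of_bipartiteNV h2 h67 h5 h75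
    ι W K 𝔭 𝔭bar κ γ hf hN hp hgood hap hsurj hK h𝔭 hι h𝔭bar hne hHeeg hcop hh hac fun h𝔭ns γ𝔭 hγ𝔭 ↦ ?_
  -- the pinned `+` tuple of conjunct (16) at this non-split datum
  have hp2 : p ≠ 2 := by omega
  have hS : AcSigned.Setting W K p κ 𝔭 𝔭bar :=
    { isElliptic := ‹_›
      p_ne_two := hp2
      goodSS := ⟨hgood, by rw [hap]; exact dvd_zero _⟩
      frobeniusTrace_eq_zero := hap
      isImaginaryQuadratic := hK
      mem := h𝔭
      mem' := h𝔭bar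
      ne := hne
      anticyclotomic := hac
      not_dvd_classNumber := hh }
  have hN' : (W.conductorNorm ℤ : ℕ) = N := by exact_mod_cast hN.symm
  have hHg : SatisfiesHeegnerHypothesis N K := fun ℓ hℓ hℓN ↦ hHeeg ℓ hℓ hℓN
  obtain ⟨ΩK, Ωp, L, hΩ, hBDP, jbar, F, _hF, hsign⟩ :=
    hP N W K p κ 𝔭 𝔭bar hS ι hf hN' hHg hcop hp hsurj hι γ hγF.out h𝔭ns γ𝔭 hγ𝔭
  obtain ⟨z, B, hB, hbase, _hzF, hT, _hdict⟩ := hsign 1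
  refine ⟨ΩK, Ωp, L, hΩ, hBDP, z, B, hT, hB, hbase, ?_⟩
  -- its root is VISIBLE (else the tuple would witness (NP)); the second law at the root gives the unit
  by_contra hNV
  refine hnotNP ⟨ι, 𝔭, 𝔭bar, κ, γ, hγF.out, h𝔭, hne, h𝔭ns, γ𝔭, hγ𝔭, ΩK, Ωp, L, z, B, hac, hι, h𝔭bar, hΩ, hBDP, hT, hB, hbase, ?_⟩
  intro q hq v hv 𝔓 h𝔓 φ hφ hφD hφF
  by_contra hres
  exact hNV (SignedBaseChangeAcDivAdmdefUnitLambdaOfLoc.hasUnitLambda_of_limitBaseClass_res_ne_zero hB hbase hq hv h𝔓 hφ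
    hφD hφF hres).2

/-! ## §3 The γ′ stub text DERIVED from the five cites and «C⁺⁺ on γ′ ∩ (NP)» -/

/-- **The line's γ′ stub text (`AdmdefLine.stub_bdpLowerHalfRatSS_unram`, v1–v16: S1 on the cell «some `q ∣ N` with `E[p]` unramified,
`N` not all-additive», `p ∤ h_K`) DERIVED** from the cites (2), (9), (10), (11), (16) and the NEW research text `UnramPlusRatNPNS` = «C⁺⁺ (a
Castella–Wan frame with the rational inclusion along every structure map) on cell γ′, asked ONLY under (NP)» — by cases on (NP) at the point:
(NP) ⟹ the research text; ¬(NP) ⟹ `cwPoint_of_facts_of_not_rootInvisible`; then `exists_pow_mul_mem_span_of_cwPoint`.  On the sub-cell where an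
unramified `q ∥ N` is SPLIT multiplicative, (NP) holds identically (Jetchev 2008 Thm 1.4: `c_q ∣` Heegner index) and nothing is closed; on the
sub-cell where every unramified bad prime is non-split, S1 is kernel modulo the five cites off (NP).  CONDITIONAL; nothing about γ′ ∩ (NP) is proved.
[cite: CastellaEtAl2025, Thm. 7.4, Thm. 7.5, §7.4] [cite: Jetchev2008, Thm. 1.4 (arXiv:math/0703431 p. 3)] [cite: Castella2018, Thm. 3.1] -/
theorem bdpLowerHalfRatSS_unram_of_facts_of_unramNP
    (h2 : ∀ (W : WeierstrassCurve ℚ) [W.IsGloballyMinimal] (K : Type) [Field K] [NumberField K]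
      (p : ℕ) [Fact p.Prime] (κ : ZpExtension K p) (𝔭 𝔭' : HeightOneSpectrum (𝓞 K)),
      longoVigni2019_thm14_signedSelmerDual_rank_one W K p κ 𝔭 𝔭')
    (h67 : ∀ (N : ℕ) [NeZero N] (W : WeierstrassCurve ℚ) [W.IsGloballyMinimal] (K : Type) [Field K] [NumberField K]
      (p : ℕ) [Fact p.Prime] (κ : ZpExtension K p) (𝔭 𝔭' : HeightOneSpectrum (𝓞 K)),
      castellaWan2024_lemma67_finrank_torsionCharIdeal N W K p κ 𝔭 𝔭')
    (h5 : ∀ (N : ℕ) [NeZero N] (W : WeierstrassCurve ℚ) [W.IsGloballyMinimal] (K : Type) [Field K] [NumberField K]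
      (p : ℕ) [Fact p.Prime] (κ : ZpExtension K p) (𝔭 𝔭' : HeightOneSpectrum (𝓞 K)),
      castellaWan2024_proofThm68_selmerRel_le_selmerSgn N W K p κ 𝔭 𝔭')
    (h75 : ∀ (N : ℕ) [NeZero N] (W : WeierstrassCurve ℚ) [W.IsGloballyMinimal] (K : Type) [Field K] [NumberField K]
      (p : ℕ) [Fact p.Prime] (κ : ZpExtension K p) (𝔭 𝔭' : HeightOneSpectrum (𝓞 K)),
      thm75_howard_rank_one_sq_le_and_le_of_hasUnitLambda N W K p κ 𝔭 𝔭')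
    (hP : thm74_eq72_exists_signedSystem_transferClass_dictionary)
    (hU : ∀ {p : ℕ} [Fact p.Prime] (ι : PadicAlgCl p ≃+* ℂ) (W : WeierstrassCurve ℚ) [W.IsElliptic]
      [W.IsGloballyMinimal] (K : Type) [Field K] [NumberField K]
      (𝔭 𝔭bar : HeightOneSpectrum (𝓞 K)) (κ : ZpExtension K p) (γ : absoluteGaloisGroup K)
      [Fact (κ.IsTopGenerator γ)] {N : ℕ} [NeZero N] {f : CuspForm (CongruenceSubgroup.Gamma0 N) 2}
      (_ : IsNewformOf W f),
      (N : ℤ) = W.conductorNorm ℤ → 5 ≤ p → W.HasGoodReductionAtPrime p → W.frobeniusTrace p = 0 →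
      Surj W p →
      IsImaginaryQuadratic K → ((Ideal.span {(p : ℤ)}).primesOver (𝓞 K)).ncard = 2 →
        ((p : ℕ) : 𝓞 K) ∈ 𝔭.asIdeal →
        (∀ (w : InfinitePlace K) (k : 𝓞 K), k ∈ 𝔭.asIdeal ↔ ‖ι.symm (w.embedding (k : K))‖ < 1) →
        ((p : ℕ) : 𝓞 K) ∈ 𝔭bar.asIdeal → 𝔭bar ≠ 𝔭 →
      (∀ ℓ : ℕ, ℓ.Prime → ℓ ∣ N → ((Ideal.span {(ℓ : ℤ)}).primesOver (𝓞 K)).ncard = 2) →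
      IsCoprime (N : ℤ) (NumberField.discr K) → ¬ p ∣ NumberField.classNumber K →
      -- cell γ′: NOT every `q ∣ N` has an inertia element moving a `p`-torsion point (some `q ∣ N` with `E[p]` unramified)
      ¬ (∀ q : ℕ, q.Prime → q ∣ N →
        ∃ v : HeightOneSpectrum (𝓞 ℚ), ((q : ℕ) : 𝓞 ℚ) ∈ v.asIdeal ∧
          ∃ 𝔓 ∈ v.primesAbove, ∃ σ ∈ 𝔓.inertia (absoluteGaloisGroup ℚ),
            ∃ P : W.geomTorsion (p : ℤ), σ • P ≠ P) →
      κ.IsAnticyclotomic →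
      -- (NP): the NON-PRIMITIVE locus — some pinned `+` tuple has bottom class invisible at every admissible Frobenius
      (∃ (ι : PadicAlgCl p ≃+* ℂ) (𝔭 𝔭bar : HeightOneSpectrum (𝓞 K)) (κ : ZpExtension K p) (γ : absoluteGaloisGroup K)
        (hγ : κ.IsTopGenerator γ) (h𝔭 : ((p : ℕ) : 𝓞 K) ∈ 𝔭.asIdeal) (hne : 𝔭bar ≠ 𝔭)
        (h𝔭ns : AcSigned.IsNonsplitIn κ 𝔭) (γ𝔭 : absoluteGaloisGroup (𝔭.adicCompletion K))
        (hγ𝔭 : κ (resGalOfEmb (closureEmb (K := K) (𝔭.adicCompletion K)) γ𝔭) = κ γ)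
        (ΩK : ℂ) (Ωp : (unrIntegers p)ˣ) (L : UnrSeries p)
        (z : AcSigned.selmerLambdaAdic (W.baseChange K) p κ γ (fun _ ↦ .sgn 1))
        (B : CastellaHsuKunduLeeLiu2025.SignedBipartiteSystem W K p κ),
        κ.IsAnticyclotomic ∧ (∀ (w : InfinitePlace K) (k : 𝓞 K), k ∈ 𝔭.asIdeal ↔ ‖ι.symm (w.embedding (k : K))‖ < 1) ∧
        ((p : ℕ) : 𝓞 K) ∈ 𝔭bar.asIdeal ∧ ΩK ≠ 0 ∧
        IsCWBDPLFunction ι 𝔭 κ γ f (NumberField.discr K) ΩK ((Ωp : unrIntegers p) : ℂ_[p]) L ∧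
        AcSigned.TransferInputs (W.baseChange K) p κ γ hγ 𝔭 h𝔭ns γ𝔭 hγ𝔭 𝔭bar (fun h ↦ hne h.symm) h𝔭 1 z L ∧
        CastellaHsuKunduLeeLiu2025.IsSignedBipartiteSystem W K p κ γ N 1 B ∧ B.IsLimitBaseClass z.1 ∧
        ∀ (q : ℕ), IsAdmissiblePrime N K (fun ℓ ↦ W.frobeniusTrace ℓ) p 1 q →
          ∀ (v : HeightOneSpectrum (𝓞 K)), ((q : ℕ) : 𝓞 K) ∈ v.asIdeal →
          ∀ 𝔓 ∈ v.primesAbove, ∀ (φ : absoluteGaloisGroup K) (hφ : φ ∈ κ.kerSubgroup),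
            φ ∈ 𝔓.decompositionSubgroup (absoluteGaloisGroup K) → IsArithFrobAt (𝓞 K) φ 𝔓 →
            resOfLe (geomTorsion (W.baseChange K) ((p : ℤ) ^ 1))
              ((Subgroup.zpowers_le.mpr hφ).trans (κ.kerSubgroup_le_layerSubgroup 0)) (z.1 0 1) = 0) →
      ∃ (ΩK : ℂ) (Ωp : (unrIntegers p)ˣ) (L : UnrSeries p),
        ΩK ≠ 0 ∧
        IsCWBDPLFunction ι 𝔭 κ γ f (NumberField.discr K) ΩK ((Ωp : unrIntegers p) : ℂ_[p]) L ∧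
        ∀ (j : ℤ_[p] →+* unrIntegers p),
          (∀ x : ℤ_[p], ((j x : unrIntegers p) : ℂ_[p]) = algebraMap ℚ_[p] ℂ_[p] (x : ℚ_[p])) →
          ∃ k : ℕ,
            Ideal.span {PowerSeries.C ((p : unrIntegers p) ^ k)} *
                (Castella2018.AcSelmer.XAc.charIdeal (W.baseChange K) p κ 𝔭bar ∅ γ).map (PowerSeries.map j) ≤
              Ideal.span {L}) :
    SignedTwoVariableInputs → Literature.NumberTheory.EllipticCurves.ModularForms.nonempty_modularParametrizationData → ∀ (W : WeierstrassCurve ℚ) [W.IsElliptic] [W.IsGloballyMinimal] (p : ℕ) [Fact p.Prime], 5 ≤ p → W.HasGoodReductionAtPrime p → W.frobeniusTrace p = 0 → Literature.NumberTheory.EllipticCurves.Rank1Residual.Surj W p → ∀ (K : Type) [Field K] [NumberField K] (ι : PadicAlgCl p ≃+* ℂ) (v vbar : IsDedekindDomain.HeightOneSpectrum (NumberField.RingOfIntegers K)) (κ₁ κ₂ : Literature.NumberTheory.EllipticCurves.ZpExtension K p) (γ₁ γ₂ : Field.absoluteGaloisGroup K) [Fact (Literature.NumberTheory.EllipticCurves.ZpExtension.IsTopGeneratorPair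 κ₁ κ₂ γ₁ γ₂)] [NeZero (NumberField.discr K).natAbs] (N : ℕ) [NeZero N] (f : CuspForm (CongruenceSubgroup.Gamma0 N) 2), Literature.NumberTheory.EllipticCurves.ModularForms.IsNewformOf W f → (N : ℤ) = W.conductorNorm ℤ → Literature.NumberTheory.EllipticCurves.IsImaginaryQuadratic K → ¬ p ∣ NumberField.classNumber K → ¬ (∀ q : ℕ, q.Prime → q ∣ N → ∃ v' : IsDedekindDomain.HeightOneSpectrum (NumberField.RingOfIntegers ℚ), ((q : ℕ) : NumberField.RingOfIntegers ℚ) ∈ v'.asIdeal ∧ ∃ 𝔓 ∈ v'.primesAbove, ∃ σ ∈ 𝔓.inertia (Field.absoluteGaloisGroup ℚ), ∃ P : W.geomTorsion (p : ℤ), σ • P ≠ P) → ¬ (∀ ℓ : ℕ, ℓ.Prime → ℓ ∣ N → ℓ ^ 2 ∣ N) → ((Ideal.span {(p : ℤ)}).primesOver (NumberField.RingOfIntegers K)).ncard = 2 → ((p : ℕ) : NumberField.RingOfIntegers K) ∈ v.asIdeal → ((p : ℕ) : NumberField.RingOfIntegers K) ∈ vbar.asIdeal → vbar ≠ v → (∀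 (w : NumberField.InfinitePlace K) (k : NumberField.RingOfIntegers K), k ∈ v.asIdeal ↔ ‖ι.symm (w.embedding (k : K))‖ < 1) → IsCoprime (N : ℤ) (NumberField.discr K) → (∀ ℓ : ℕ, ℓ.Prime → ℓ ∣ N → ((Ideal.span {(ℓ : ℤ)}).primesOver (NumberField.RingOfIntegers K)).ncard = 2) → Odd (NumberField.discr K) → NumberField.discr K ≠ -3 → κ₁.IsCyclotomic → κ₂.IsAnticyclotomic → (haveI : Fact (κ₂.IsTopGenerator γ₂) := ⟨Literature.NumberTheory.EllipticCurves.YanZhu2026.isTopGenerator_of_pair (κ₁ := κ₁) (γ₁ := γ₁)⟩; Module.IsTorsion (Literature.NumberTheory.EllipticCurves.IwasawaAlgebra p) (Literature.NumberTheory.EllipticCurves.Castella2018.AcSelmer.XAc (W.baseChange K) p κ₂ vbar ∅ γ₂)) → ∀ (ΩK : ℂ) (Ωp' : (Literature.NumberTheory.EllipticCurves.unrIntegers p)ˣ) (L : Literature.NumberTheory.EllipticCurves.UnrSeries p), ΩK ≠ 0 → Literature.NumberTheory.EllipticCurves.IsBDPLFunction ι v κ₂ γ₂ f ΩK ((Ωp'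 : Literature.NumberTheory.EllipticCurves.unrIntegers p) : PadicComplex p) L → ∀ J : ℤ_[p] →+* PadicComplexInt p, (∀ x : ℤ_[p], ((J x : PadicComplexInt p) : PadicComplex p) = ((x : ℚ_[p]) : PadicComplex p)) → ∀ (J₀ : Literature.NumberTheory.EllipticCurves.unrIntegers p →+* PadicComplexInt p), (∀ x : Literature.NumberTheory.EllipticCurves.unrIntegers p, ((J₀ x : PadicComplexInt p) : PadicComplex p) = (x : PadicComplex p)) → ∃ k : ℕ, ∀ y ∈ (haveI : Fact (κ₂.IsTopGenerator γ₂) := ⟨Literature.NumberTheory.EllipticCurves.YanZhu2026.isTopGenerator_of_pair (κ₁ := κ₁) (γ₁ := γ₁)⟩; Literature.NumberTheory.EllipticCurves.Castella2018.AcSelmer.XAc.charIdeal (W.baseChange K) p κ₂ vbar ∅ γ₂).map (PowerSeries.map J), PowerSeries.C (((p : ℕ) : PadicComplexInt p) ^ k) * y ∈ Ideal.span {PowerSeries.map J₀ L} := by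
  intro hIn hmodP W _ _ p _ hp hgood ha0 hs K _ _ ι v vbar κ₁ κ₂ γ₁ γ₂ _ _ N _ f hf hN hK hh hram hsq hsplit hv hvbar hvv hι hcop
    hHeeg hodd hne3 hκ₁ hκ₂ htors ΩK Ωp' L hΩK hL J hJ J₀ hJ₀
  haveI hγF : Fact (κ₂.IsTopGenerator γ₂) := ⟨isTopGenerator_of_pair (κ₁ := κ₁) (γ₁ := γ₁)⟩
  refine exists_pow_mul_mem_span_of_cwPoint ι W K v vbar κ₂ γ₂ hN hp hgood hK hsplit hκ₂ ?_ ΩK Ωp' L hΩK hL J hJ J₀ hJ₀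
  by_cases hNP : (∃ (ι : PadicAlgCl p ≃+* ℂ) (𝔭 𝔭bar : HeightOneSpectrum (𝓞 K)) (κ : ZpExtension K p) (γ : absoluteGaloisGroup K)
      (hγ : κ.IsTopGenerator γ) (h𝔭 : ((p : ℕ) : 𝓞 K) ∈ 𝔭.asIdeal) (hne : 𝔭bar ≠ 𝔭)
      (h𝔭ns : AcSigned.IsNonsplitIn κ 𝔭) (γ𝔭 : absoluteGaloisGroup (𝔭.adicCompletion K))
      (hγ𝔭 : κ (resGalOfEmb (closureEmb (K := K) (𝔭.adicCompletion K)) γ𝔭) = κ γ)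
      (ΩK : ℂ) (Ωp : (unrIntegers p)ˣ) (L : UnrSeries p)
      (z : AcSigned.selmerLambdaAdic (W.baseChange K) p κ γ (fun _ ↦ .sgn 1))
      (B : CastellaHsuKunduLeeLiu2025.SignedBipartiteSystem W K p κ),
      κ.IsAnticyclotomic ∧ (∀ (w : InfinitePlace K) (k : 𝓞 K), k ∈ 𝔭.asIdeal ↔ ‖ι.symm (w.embedding (k : K))‖ < 1) ∧
      ((p : ℕ) : 𝓞 K) ∈ 𝔭bar.asIdeal ∧ ΩK ≠ 0 ∧
      IsCWBDPLFunction ι 𝔭 κ γ f (NumberField.discr K) ΩK ((Ωp : unrIntegers p) : ℂ_[p]) L ∧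
      AcSigned.TransferInputs (W.baseChange K) p κ γ hγ 𝔭 h𝔭ns γ𝔭 hγ𝔭 𝔭bar (fun h ↦ hne h.symm) h𝔭 1 z L ∧
      CastellaHsuKunduLeeLiu2025.IsSignedBipartiteSystem W K p κ γ N 1 B ∧ B.IsLimitBaseClass z.1 ∧
      ∀ (q : ℕ), IsAdmissiblePrime N K (fun ℓ ↦ W.frobeniusTrace ℓ) p 1 q →
        ∀ (v : HeightOneSpectrum (𝓞 K)), ((q : ℕ) : 𝓞 K) ∈ v.asIdeal →
        ∀ 𝔓 ∈ v.primesAbove, ∀ (φ : absoluteGaloisGroup K) (hφ : φ ∈ κ.kerSubgroup),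
          φ ∈ 𝔓.decompositionSubgroup (absoluteGaloisGroup K) → IsArithFrobAt (𝓞 K) φ 𝔓 →
          resOfLe (geomTorsion (W.baseChange K) ((p : ℤ) ^ 1))
            ((Subgroup.zpowers_le.mpr hφ).trans (κ.kerSubgroup_le_layerSubgroup 0)) (z.1 0 1) = 0)
  · exact hU ι W K v vbar κ₂ γ₂ hf hN hp hgood ha0 hs hK hsplit hv hι hvbar hvv hHeeg hcop hh hram hκ₂ hNP
  · exact cwPoint_of_facts_of_not_rootInvisible h2 h67 h5 h75 hP ι W K v vbar κ₂ γ₂ hf hN hp hgood ha0 hs hK hv hι hvbar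
      hvv hHeeg hcop hh hκ₂ hNP

end Summit.BirchSwinnertonDyer.BirchSwinnertonDyer.Theorems.SignedBaseChangeAcDivAdmdefUnramRootDichotomy

end
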